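import Summits.HodgeConjecture.HodgeConjecture.Theorems.K2E3OrbitClosureHermitianPairs
import HarnessLib

/-!
# K2 ∕ E3 «EllipticInputs», 13a road A (structure of `U_N(H)(L⁺_v)`), helper J4 (i)-alg:
# the WITT DECOMPOSITION of a non-degenerate hermitian space over a field with involution

Cell `hodgecm-mathlib` (Track B «K2-LIT»), item h413 = `stmt-HodgeConjecture-24833`; author K2E3-p10 (g2); count-neutral helper
(`--supports stmt-HodgeConjecture-24833 --as helper`) for the 13a line (socket U12-g `sig_K2E3LocalIrrepAdmissible`, road A,
K2E3-p13 MEMO `MEMO-13a-admissibility-generalN` §5 «J4 (i): Witt basis of `(K^N, H_w)`»).  PROOF lane: theorems only, no `def`,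
no `instance`, no `sorry`; pure linear algebra over Mathlib and ★ `K2E3OrbitClosureHermitianPairs` (K2E3-p10 (g0)).

Setting: a field `K` with `2 ≠ 0`, an involution `σ : K →+* K`, a finite-dimensional `K`-space `V` and a `σ`-sesquilinear form
`h : V →ₛₗ[σ] V →ₗ[K] K` (semilinear in the FIRST variable, as `h(x, y) = (σ x)ᵀ J y` of ★ `UnitaryGroup.hermForm`) which is
HERMITIAN (`h y x = σ (h x y)`) and NON-DEGENERATE.

* §1 small tools: the line spanned by an isotropic vector is totally isotropic; the hyperbolic plane spanned by a hyperbolic pair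
  `(a, b)` (`h a a = 0 = h b b`, `h a b = 1`) meets its orthogonal trivially, so `V = ⟨a, b⟩ ⊕ ⟨a, b⟩^⊥` with `h` non-degenerate on
  `⟨a, b⟩^⊥` of dimension `dim V − 2`.
* §2 **`exists_witt_decomposition`** [Dieudonne1971GroupesClassiques, Chap. I §11]: there are `r : ℕ` and a HYPERBOLIC FRAME
  `w, w' : Fin r → V` — `h(w_i, w_j) = 0 = h(w'_i, w'_j)`, `h(w_i, w'_j) = δ_{ij}` — whose common orthogonal is ANISOTROPIC:
  every `u` with `h(w_i, u) = 0 = h(w'_i, u)` for all `i` and `h(u, u) = 0` is `0`.  (Induction on `dim V`: split off the hyperbolic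
  plane through an isotropic vector and a hyperbolic partner, ★ `exists_hyperbolic_partner`.)  So `V = (⊕ K w_i ⊕ K w'_i) ⊥ V_an`
  with `V_an` anisotropic: the maximal isotropic flag `⟨w_1⟩ ⊂ ⟨w_1, w_2⟩ ⊂ ⋯`, its stabilisers (the standard parabolics), the Witt
  cocharacters `w_i ↦ ϖ w_i, w'_i ↦ (σ ϖ)⁻¹ w'_i` and the anisotropic kernel `U(V_an)` of road A's J4∕J6 are all read off this frame.
* §3 consequences: the frame is linearly independent (`linearIndependent_witt_frame`), and for ANY hyperbolic frame the span `F`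
  of the frame satisfies `F ⊓ F^⊥ = ⊥`, `V = F ⊕ F^⊥`, `dim F = 2r`, `2r + dim F^⊥ = dim V`, `h|_{F^⊥}` non-degenerate
  (`isCompl_span_frame_orthogonal`, `finrank_span_frame`, `two_mul_add_finrank_orthogonal_eq`, `nondegenerate_orthogonal_frame`).

References: J. Dieudonné, *La géométrie des groupes classiques*, 3e éd. (1971), Chap. I §11 (décomposition de Witt des formes
sesquilinéaires non dégénérées); W. Scharlau, *Quadratic and Hermitian Forms* (1985), Ch. 7 §9.
-/

set_option autoImplicit false
set_option linter.dupNamespace false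

namespace Summit.HodgeConjecture.HodgeConjecture.Cruxes.H413.K2E3HermitianWittDecomposition

open Module K2E3OrbitClosureHermitianPairs

variable {K : Type*} [Field K] {σ : K →+* K} {V : Type*} [AddCommGroup V] [Module K V]
  (h : V →ₛₗ[σ] V →ₗ[K] K)

/-! ## §1 Isotropic lines and hyperbolic planes -/

/-- The line through an isotropic vector is totally isotropic. [folklore] -/
theorem isotropic_span_singleton {a : V} (ha : h a a = 0) :
    ∀ x ∈ Submodule.span K (Set.range ![a]), ∀ y ∈ Submodule.span K (Set.range ![a]), h x y = 0 := by
  intro x hx y hy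
  obtain ⟨c, rfl⟩ := (Submodule.mem_span_range_iff_exists_fun K).1 hx
  obtain ⟨d, rfl⟩ := (Submodule.mem_span_range_iff_exists_fun K).1 hy
  simp only [Fin.sum_univ_one, Matrix.cons_val_zero, LinearMap.map_smulₛₗ, LinearMap.smul_apply, map_smul,
    smul_eq_mul, ha, mul_zero]

/-- A hyperbolic pair is linearly independent. [folklore] -/
theorem linearIndependent_hyperbolic_pair (hherm : ∀ x y, h y x = σ (h x y)) {a b : V} (haa : h a a = 0)
    (hab : h a b = 1) (hbb : h b b = 0) : LinearIndependent K ![a, b] := by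
  have hba : h b a = 1 := by rw [hherm, hab, map_one]
  refine LinearIndependent.pair_iff.2 fun s t hst => ?_
  have h1 : h a (s • a + t • b) = 0 := by rw [hst, map_zero]
  have h2 : h b (s • a + t • b) = 0 := by rw [hst, map_zero]
  rw [map_add, map_smul, map_smul, smul_eq_mul, smul_eq_mul, haa, hab, mul_zero, zero_add, mul_one] at h1
  rw [map_add, map_smul, map_smul, smul_eq_mul, smul_eq_mul, hba, hbb, mul_zero, add_zero, mul_one] at h2
  exact ⟨h2, h1⟩

/-- Membership in the orthogonal of the plane `⟨a, b⟩`: `h a v = 0` and `h b v = 0`. [folklore] -/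
theorem mem_orthogonal_pair_iff {a b : V} (hli : LinearIndependent K ![a, b]) (v : V) :
    v ∈ (Submodule.span K (Set.range ![a, b])).orthogonalBilin h ↔ h a v = 0 ∧ h b v = 0 := by
  rw [Submodule.mem_orthogonalBilin_iff]
  have key : (∀ w ∈ Submodule.span K (Set.range ![a, b]), h w v = 0) ↔ ∀ i, h (Basis.span hli i) v = 0 :=
    forall_mem_apply_eq_zero_iff h (Basis.span hli) v
  rw [key, Fin.forall_fin_two, Basis.span_apply, Basis.span_apply]
  simp

/-- The hyperbolic plane `⟨a, b⟩` meets its orthogonal trivially. [folklore] -/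
theorem disjoint_span_pair_orthogonal (hherm : ∀ x y, h y x = σ (h x y)) {a b : V} (haa : h a a = 0)
    (hab : h a b = 1) (hbb : h b b = 0) :
    Disjoint (Submodule.span K (Set.range ![a, b])) ((Submodule.span K (Set.range ![a, b])).orthogonalBilin h) := by
  have hba : h b a = 1 := by rw [hherm, hab, map_one]
  have hli := linearIndependent_hyperbolic_pair h hherm haa hab hbb
  rw [Submodule.disjoint_def]
  intro x hx hx'
  obtain ⟨c, rfl⟩ := (Submodule.mem_span_range_iff_exists_fun K).1 hx
  obtain ⟨h1, h2⟩ := (mem_orthogonal_pair_iff h hli _).1 hx'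
  simp only [Fin.sum_univ_two, Matrix.cons_val_zero, Matrix.cons_val_one, map_add, map_smul,
    smul_eq_mul, haa, hab, hba, hbb, mul_zero, zero_add, add_zero, mul_one] at h1 h2
  simp [h1, h2]

/-! ## §2 The Witt decomposition -/

/-- **Witt decomposition** (induction on the dimension, all finite-dimensional non-degenerate hermitian spaces at once).
[cite: Dieudonne1971GroupesClassiques, Chap. I §11] -/
theorem exists_witt_decomposition_aux (hσ : ∀ a, σ (σ a) = a) (h2 : (2 : K) ≠ 0) (n : ℕ) :
    ∀ (V : Type*) [AddCommGroup V] [Module K V] [FiniteDimensional K V], finrank K V = n →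
      ∀ (h : V →ₛₗ[σ] V →ₗ[K] K), (∀ x y, h y x = σ (h x y)) → (∀ x, (∀ y, h x y = 0) → x = 0) →
        ∃ (r : ℕ) (w w' : Fin r → V),
          (∀ i j, h (w i) (w j) = 0) ∧ (∀ i j, h (w' i) (w' j) = 0) ∧ (∀ i j, h (w i) (w' j) = if i = j then 1 else 0) ∧
          ∀ u : V, (∀ i, h (w i) u = 0) → (∀ i, h (w' i) u = 0) → h u u = 0 → u = 0 := by
  induction n using Nat.strong_induction_on with
  | _ n ih =>
  intro V _ _ _ hn h hherm hnd
  classical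
  by_cases han : ∀ u : V, h u u = 0 → u = 0
  · -- anisotropic: empty frame
    exact ⟨0, Fin.elim0, Fin.elim0, fun i => i.elim0, fun i => i.elim0, fun i => i.elim0, fun u _ _ hu => han u hu⟩
  · -- an isotropic vector `a ≠ 0`, a hyperbolic partner `b`, and the plane `⟨a, b⟩` splits off
    push Not at han
    obtain ⟨a, haa, ha0⟩ := han
    have hlia : LinearIndependent K ![a] := by
      rw [linearIndependent_unique_iff]; exact ha0
    obtain ⟨b', hab', hbb'⟩ := exists_hyperbolic_partner h hσ h2 hherm hnd (isotropic_span_singleton h haa) (Basis.span hlia)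
    set b : V := b' 0 with hbdef
    have hab : h a b = 1 := by
      have := hab' 0 0
      rwa [Basis.span_apply, if_pos rfl] at this
    have hbb : h b b = 0 := hbb' 0 0
    have hba : h b a = 1 := by rw [hherm, hab, map_one]
    have hli := linearIndependent_hyperbolic_pair h hherm haa hab hbb
    set F := Submodule.span K (Set.range ![a, b]) with hFdef
    set U := F.orthogonalBilin h with hUdef
    have hFU : IsCompl F U := isCompl_orthogonalBilin_of_disjoint h (disjoint_span_pair_orthogonal h hherm haa hab hbb)
    have hFdim : finrank K F = 2 := by
      rw [hFdef, finrank_span_eq_card hli, Fintype.card_fin]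
    have hUdim : finrank K U < finrank K V := by
      have := Submodule.finrank_add_eq_of_isCompl hFU
      omega
    have hndU : ∀ x : U, (∀ y : U, h x y = 0) → x = 0 :=
      nondegenerate_restrict_orthogonalBilin h hherm hnd hFU.sup_eq_top
    have hmemU : ∀ v : V, v ∈ U ↔ h a v = 0 ∧ h b v = 0 := fun v => mem_orthogonal_pair_iff h hli v
    -- induction hypothesis on `U = ⟨a, b⟩^⊥`
    obtain ⟨r, w, w', hww₀, hw'w'₀, hww'₀, hanU₀⟩ :=
      ih _ (hn ▸ hUdim) U rfl (h.domRestrict₁₂ U U) (fun x y => hherm x y) hndU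
    -- read the frame of `U` in `V` (`h.domRestrict₁₂ U U x y = h x y`, definitionally)
    have hww : ∀ i j, h (w i : V) (w j : V) = 0 := fun i j => hww₀ i j
    have hw'w' : ∀ i j, h (w' i : V) (w' j : V) = 0 := fun i j => hw'w'₀ i j
    have hww' : ∀ i j, h (w i : V) (w' j : V) = if i = j then 1 else 0 := fun i j => hww'₀ i j
    have hanU : ∀ u : U, (∀ i, h (w i : V) (u : V) = 0) → (∀ i, h (w' i : V) (u : V) = 0) → h (u : V) (u : V) = 0 → u = 0 :=
      fun u H1 H2 H3 => hanU₀ u H1 H2 H3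
    have hwU : ∀ i, h a (w i) = 0 ∧ h b (w i) = 0 := fun i => (hmemU _).1 (w i).2
    have hw'U : ∀ i, h a (w' i) = 0 ∧ h b (w' i) = 0 := fun i => (hmemU _).1 (w' i).2
    refine ⟨r + 1, Fin.cons a fun i => (w i : V), Fin.cons b fun i => (w' i : V), ?_, ?_, ?_, ?_⟩
    · intro i j
      cases i using Fin.cases with
      | zero =>
        cases j using Fin.cases with
        | zero => simpa using haa
        | succ j => simpa using (hwU j).1
      | succ i =>
        cases j using Fin.cases with
        | zero => simpa [apply_eq_zero_comm h hherm] using (hwU i).1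
        | succ j => simpa using hww i j
    · intro i j
      cases i using Fin.cases with
      | zero =>
        cases j using Fin.cases with
        | zero => simpa using hbb
        | succ j => simpa using (hw'U j).2
      | succ i =>
        cases j using Fin.cases with
        | zero => simpa [apply_eq_zero_comm h hherm] using (hw'U i).2
        | succ j => simpa using hw'w' i j
    · intro i j
      cases i using Fin.cases with
      | zero =>
        cases j using Fin.cases with
        | zero => simpa using hab
        | succ j => simpa [(Fin.succ_ne_zero j).symm] using (hw'U j).1
      | succ i =>
        cases j using Fin.cases with
        | zero => simpa [Fin.succ_ne_zero i, apply_eq_zero_comm h hherm] using (hwU i).2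
        | succ j => simpa [Fin.succ_inj] using hww' i j
    · intro u hu hu' huu
      have haU : h a u = 0 := by simpa using hu 0
      have hbU : h b u = 0 := by simpa using hu' 0
      have hmem : u ∈ U := (hmemU u).2 ⟨haU, hbU⟩
      have key := hanU ⟨u, hmem⟩ (fun i => by simpa using hu i.succ) (fun i => by simpa using hu' i.succ) huu
      simpa using congrArg Subtype.val key

variable [FiniteDimensional K V]

/-- **The Witt decomposition of a non-degenerate hermitian space** over a field with `2 ≠ 0` and an involution `σ`: a hyperbolic
frame `w, w' : Fin r → V` (`h(w_i, w_j) = 0 = h(w'_i, w'_j)`, `h(w_i, w'_j) = δ_{ij}`) whose common orthogonal is anisotropic.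
[cite: Dieudonne1971GroupesClassiques, Chap. I §11] -/
theorem exists_witt_decomposition (hσ : ∀ a, σ (σ a) = a) (h2 : (2 : K) ≠ 0) (hherm : ∀ x y, h y x = σ (h x y))
    (hnd : ∀ x, (∀ y, h x y = 0) → x = 0) :
    ∃ (r : ℕ) (w w' : Fin r → V),
      (∀ i j, h (w i) (w j) = 0) ∧ (∀ i j, h (w' i) (w' j) = 0) ∧ (∀ i j, h (w i) (w' j) = if i = j then 1 else 0) ∧
      ∀ u : V, (∀ i, h (w i) u = 0) → (∀ i, h (w' i) u = 0) → h u u = 0 → u = 0 :=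
  exists_witt_decomposition_aux hσ h2 (finrank K V) V rfl h hherm hnd

/-! ## §3 Consequences for a hyperbolic frame -/

omit [FiniteDimensional K V] in
/-- Pairing a combination `Σ c_i w_i + Σ d_i w'_i` of a hyperbolic frame with `w_k` picks out `d_k`. [folklore] -/
theorem apply_frame_combination_left {r : ℕ} {w w' : Fin r → V} (hww : ∀ i j, h (w i) (w j) = 0)
    (hww' : ∀ i j, h (w i) (w' j) = if i = j then 1 else 0) (c d : Fin r → K) (k : Fin r) :
    h (w k) (∑ i, c i • w i + ∑ i, d i • w' i) = d k := by
  classical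
  rw [map_add, apply_sum_smul_right, apply_sum_smul_right]
  simp [hww, hww', mul_ite]

omit [FiniteDimensional K V] in
/-- Pairing a combination `Σ c_i w_i + Σ d_i w'_i` of a hyperbolic frame with `w'_k` picks out `c_k` (hermitian `h`, involutive `σ`).
[folklore] -/
theorem apply_frame_combination_right (hherm : ∀ x y, h y x = σ (h x y)) {r : ℕ} {w w' : Fin r → V}
    (hw'w' : ∀ i j, h (w' i) (w' j) = 0) (hww' : ∀ i j, h (w i) (w' j) = if i = j then 1 else 0)
    (c d : Fin r → K) (k : Fin r) :
    h (w' k) (∑ i, c i • w i + ∑ i, d i • w' i) = c k := by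
  classical
  have hw'w : ∀ i j, h (w' i) (w j) = if j = i then 1 else 0 := fun i j => by
    rw [hherm, hww']; split_ifs <;> simp
  rw [map_add, apply_sum_smul_right, apply_sum_smul_right]
  simp [hw'w, hw'w', mul_ite]

omit [FiniteDimensional K V] in
/-- **A hyperbolic frame is linearly independent.** [cite: Dieudonne1971GroupesClassiques, Chap. I §11] -/
theorem linearIndependent_witt_frame (hherm : ∀ x y, h y x = σ (h x y)) {r : ℕ} {w w' : Fin r → V}
    (hww : ∀ i j, h (w i) (w j) = 0) (hw'w' : ∀ i j, h (w' i) (w' j) = 0)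
    (hww' : ∀ i j, h (w i) (w' j) = if i = j then 1 else 0) :
    LinearIndependent K (Sum.elim w w') := by
  classical
  rw [Fintype.linearIndependent_iff]
  intro c hc
  have hsum : ∑ k, c k • Sum.elim w w' k = ∑ i, c (Sum.inl i) • w i + ∑ i, c (Sum.inr i) • w' i := by
    rw [Fintype.sum_sum_type]; rfl
  rw [hsum] at hc
  have h1 : ∀ k, c (Sum.inr k) = 0 := fun k => by
    rw [← apply_frame_combination_left h hww hww' (fun i => c (Sum.inl i)) (fun i => c (Sum.inr i)) k, hc, map_zero]
  have h2 : ∀ k, c (Sum.inl k) = 0 := fun k => by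
    rw [← apply_frame_combination_right h hherm hw'w' hww' (fun i => c (Sum.inl i)) (fun i => c (Sum.inr i)) k, hc,
      map_zero]
  rintro (k | k)
  · exact h2 k
  · exact h1 k

omit [FiniteDimensional K V] in
/-- Membership in the orthogonal of the span `F` of a hyperbolic frame: `h(w_i, v) = 0 = h(w'_i, v)` for all `i`. [folklore] -/
theorem mem_orthogonal_frame_iff (hherm : ∀ x y, h y x = σ (h x y)) {r : ℕ} {w w' : Fin r → V}
    (hww : ∀ i j, h (w i) (w j) = 0) (hw'w' : ∀ i j, h (w' i) (w' j) = 0)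
    (hww' : ∀ i j, h (w i) (w' j) = if i = j then 1 else 0) (v : V) :
    v ∈ (Submodule.span K (Set.range (Sum.elim w w'))).orthogonalBilin h ↔ (∀ i, h (w i) v = 0) ∧ ∀ i, h (w' i) v = 0 := by
  have hli := linearIndependent_witt_frame h hherm hww hw'w' hww'
  rw [Submodule.mem_orthogonalBilin_iff, forall_mem_apply_eq_zero_iff h (Basis.span hli) v]
  constructor
  · intro H
    exact ⟨fun i => by simpa [Basis.span_apply] using H (Sum.inl i), fun i => by simpa [Basis.span_apply] using H (Sum.inr i)⟩
  · rintro ⟨H1, H2⟩ (i | i)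
    · simpa [Basis.span_apply] using H1 i
    · simpa [Basis.span_apply] using H2 i

omit [FiniteDimensional K V] in
/-- The span `F` of a hyperbolic frame meets `F^⊥` trivially. [cite: Dieudonne1971GroupesClassiques, Chap. I §11] -/
theorem disjoint_span_frame_orthogonal (hherm : ∀ x y, h y x = σ (h x y)) {r : ℕ} {w w' : Fin r → V}
    (hww : ∀ i j, h (w i) (w j) = 0) (hw'w' : ∀ i j, h (w' i) (w' j) = 0)
    (hww' : ∀ i j, h (w i) (w' j) = if i = j then 1 else 0) :
    Disjoint (Submodule.span K (Set.range (Sum.elim w w')))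
      ((Submodule.span K (Set.range (Sum.elim w w'))).orthogonalBilin h) := by
  classical
  rw [Submodule.disjoint_def]
  intro x hx hx'
  obtain ⟨c, rfl⟩ := (Submodule.mem_span_range_iff_exists_fun K).1 hx
  obtain ⟨H1, H2⟩ := (mem_orthogonal_frame_iff h hherm hww hw'w' hww' _).1 hx'
  have hsum : ∑ k, c k • Sum.elim w w' k = ∑ i, c (Sum.inl i) • w i + ∑ i, c (Sum.inr i) • w' i := by
    rw [Fintype.sum_sum_type]; rfl
  have hc1 : ∀ k, c (Sum.inr k) = 0 := fun k => by
    rw [← apply_frame_combination_left h hww hww' (fun i => c (Sum.inl i)) (fun i => c (Sum.inr i)) k, ← hsum]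
    exact H1 k
  have hc2 : ∀ k, c (Sum.inl k) = 0 := fun k => by
    rw [← apply_frame_combination_right h hherm hw'w' hww' (fun i => c (Sum.inl i)) (fun i => c (Sum.inr i)) k, ← hsum]
    exact H2 k
  rw [hsum]
  simp [hc1, hc2]

/-- **`V = F ⊕ F^⊥`** for the span `F` of a hyperbolic frame. [cite: Dieudonne1971GroupesClassiques, Chap. I §11] -/
theorem isCompl_span_frame_orthogonal (hherm : ∀ x y, h y x = σ (h x y)) {r : ℕ} {w w' : Fin r → V}
    (hww : ∀ i j, h (w i) (w j) = 0) (hw'w' : ∀ i j, h (w' i) (w' j) = 0)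
    (hww' : ∀ i j, h (w i) (w' j) = if i = j then 1 else 0) :
    IsCompl (Submodule.span K (Set.range (Sum.elim w w')))
      ((Submodule.span K (Set.range (Sum.elim w w'))).orthogonalBilin h) :=
  isCompl_orthogonalBilin_of_disjoint h (disjoint_span_frame_orthogonal h hherm hww hw'w' hww')

omit [FiniteDimensional K V] in
/-- **`dim F = 2r`** for the span `F` of a hyperbolic frame of length `r`. [cite: Dieudonne1971GroupesClassiques, Chap. I §11] -/
theorem finrank_span_frame (hherm : ∀ x y, h y x = σ (h x y)) {r : ℕ} {w w' : Fin r → V}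
    (hww : ∀ i j, h (w i) (w j) = 0) (hw'w' : ∀ i j, h (w' i) (w' j) = 0)
    (hww' : ∀ i j, h (w i) (w' j) = if i = j then 1 else 0) :
    finrank K (Submodule.span K (Set.range (Sum.elim w w'))) = 2 * r := by
  rw [finrank_span_eq_card (linearIndependent_witt_frame h hherm hww hw'w' hww'), Fintype.card_sum, Fintype.card_fin]
  ring

/-- **`2r + dim F^⊥ = dim V`**: the Witt index `r` of a frame and the dimension of its anisotropic∕orthogonal part.
[cite: Dieudonne1971GroupesClassiques, Chap. I §11] -/
theorem two_mul_add_finrank_orthogonal_eq (hherm : ∀ x y, h y x = σ (h x y)) {r : ℕ} {w w' : Fin r → V}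
    (hww : ∀ i j, h (w i) (w j) = 0) (hw'w' : ∀ i j, h (w' i) (w' j) = 0)
    (hww' : ∀ i j, h (w i) (w' j) = if i = j then 1 else 0) :
    2 * r + finrank K ((Submodule.span K (Set.range (Sum.elim w w'))).orthogonalBilin h) = finrank K V := by
  rw [← finrank_span_frame h hherm hww hw'w' hww']
  exact Submodule.finrank_add_eq_of_isCompl (isCompl_span_frame_orthogonal h hherm hww hw'w' hww')

/-- **`h` is non-degenerate on `F^⊥`** for the span `F` of a hyperbolic frame (hermitian non-degenerate `h`).
[cite: Dieudonne1971GroupesClassiques, Chap. I §11] -/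
theorem nondegenerate_orthogonal_frame (hherm : ∀ x y, h y x = σ (h x y)) (hnd : ∀ x, (∀ y, h x y = 0) → x = 0)
    {r : ℕ} {w w' : Fin r → V}
    (hww : ∀ i j, h (w i) (w j) = 0) (hw'w' : ∀ i j, h (w' i) (w' j) = 0)
    (hww' : ∀ i j, h (w i) (w' j) = if i = j then 1 else 0)
    (x : (Submodule.span K (Set.range (Sum.elim w w'))).orthogonalBilin h)
    (hx : ∀ y : (Submodule.span K (Set.range (Sum.elim w w'))).orthogonalBilin h, h x y = 0) : x = 0 :=
  nondegenerate_restrict_orthogonalBilin h hherm hnd (isCompl_span_frame_orthogonal h hherm hww hw'w' hww').sup_eq_top x hx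

/-- **The Witt decomposition, packaged with its dimension count**: a hyperbolic frame of length `r` with anisotropic orthogonal
and `2r + dim (frame)^⊥ = dim V`. [cite: Dieudonne1971GroupesClassiques, Chap. I §11] -/
theorem exists_witt_decomposition' (hσ : ∀ a, σ (σ a) = a) (h2 : (2 : K) ≠ 0) (hherm : ∀ x y, h y x = σ (h x y))
    (hnd : ∀ x, (∀ y, h x y = 0) → x = 0) :
    ∃ (r : ℕ) (w w' : Fin r → V),
      (∀ i j, h (w i) (w j) = 0) ∧ (∀ i j, h (w' i) (w' j) = 0) ∧ (∀ i j, h (w i) (w' j) = if i = j then 1 else 0) ∧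
      LinearIndependent K (Sum.elim w w') ∧
      2 * r + finrank K ((Submodule.span K (Set.range (Sum.elim w w'))).orthogonalBilin h) = finrank K V ∧
      ∀ u ∈ (Submodule.span K (Set.range (Sum.elim w w'))).orthogonalBilin h, h u u = 0 → u = 0 := by
  obtain ⟨r, w, w', hww, hw'w', hww', han⟩ := exists_witt_decomposition h hσ h2 hherm hnd
  refine ⟨r, w, w', hww, hw'w', hww', linearIndependent_witt_frame h hherm hww hw'w' hww',
    two_mul_add_finrank_orthogonal_eq h hherm hww hw'w' hww', fun u hu huu => ?_⟩
  obtain ⟨H1, H2⟩ := (mem_orthogonal_frame_iff h hherm hww hw'w' hww' u).1 hu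
  exact han u H1 H2 huu

end Summit.HodgeConjecture.HodgeConjecture.Cruxes.H413.K2E3HermitianWittDecomposition
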